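import Summits.NavierStokesRegularity.NavierStokesRegularity.Theorems.FilamentSkeletonRssCoreLinearInvertibilityOddAttenuationIdentities
import Summits.AnomalousDissipation.AnomalousDissipation.Theorems.MarginalStabilityChainStretchedVortexRowsStubCoreLAngularPairingTools
import Summits.AnomalousDissipation.AnomalousDissipation.Theorems.MarginalStabilityChainStretchedVortexRowsStubCoreInverseAngular

/-!
# Tools C for stub `stub_oddAttenuation` of crux `CoreLinearInvertibility`
# (stmt-NavierStokesRegularity-17973), line `Sketch`: `⟨Δu, ∂_θu⟩ = 0`

For `u ∈ C²(ℝ²)` with `u, Du, D²u` of Gaussian decay `e^{−|x|²/8}` (times polynomials):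
`∫ Du[x^⊥] Δu = 0`. One integration by parts in each coordinate direction (tools A/B); the
remaining integrand `∑ᵢ ∂ᵢu ∂ᵢ(∂_θu)` is `½ ∂_θ|∇u|² = ½ (−x₁∂₀ + x₀∂₁)|∇u|²` because the commutator
`[∂ᵢ, ∂_θ]u = Du[eᵢ^⊥]` is orthogonal to `∇u` and `D²u` is symmetric, and `∫ xⱼ ∂ᵢ|∇u|² = 0`
for `i ≠ j` (the angular-momentum multiplier commutes with the Laplacian; Gallay–Wayne 2005 §4).
-/

set_option linter.dupNamespace false

noncomputable section

namespace Summit.NavierStokesRegularity.NavierStokesRegularity.Theorems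

open MeasureTheory Filter Topology Set
open Literature.Analysis.FluidPDE
open Summit.AnomalousDissipation.AnomalousDissipation.Theorems.MarginalStabilityChainStretchedVortexRows
open scoped InnerProductSpace Laplacian ContDiff

section Decay

variable {u : EuclideanSpace ℝ (Fin 2) → ℝ} (hu : ContDiff ℝ 2 u)
  (hB : ∃ (C : ℝ) (N : ℕ), ∀ x, |u x| ≤ C * (1 + ‖x‖) ^ N * Real.exp (-(1 / 8 * ‖x‖ ^ 2)) ∧
      ‖fderiv ℝ u x‖ ≤ C * (1 + ‖x‖) ^ N * Real.exp (-(1 / 8 * ‖x‖ ^ 2)) ∧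
      ‖fderiv ℝ (fderiv ℝ u) x‖ ≤ C * (1 + ‖x‖) ^ N * Real.exp (-(1 / 8 * ‖x‖ ^ 2)))

/-! ### `∫ (∂_θu) Δu = 0` -/

include hu in
/-- `D(|∇u|²)(x)[w] = 2 ∂₀u D²u[w][e₀] + 2 ∂₁u D²u[w][e₁]`. [folklore] -/
theorem fderiv_gradSq_apply (x w : EuclideanSpace ℝ (Fin 2)) :
    fderiv ℝ (fun y => fderiv ℝ u y (EuclideanSpace.single 0 1) ^ 2 +
        fderiv ℝ u y (EuclideanSpace.single 1 1) ^ 2) x w =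
      2 * fderiv ℝ u x (EuclideanSpace.single 0 1) * fderiv ℝ (fderiv ℝ u) x w (EuclideanSpace.single 0 1) +
        2 * fderiv ℝ u x (EuclideanSpace.single 1 1) *
          fderiv ℝ (fderiv ℝ u) x w (EuclideanSpace.single 1 1) := by
  have hdi : ∀ e, HasFDerivAt (fun y => fderiv ℝ u y e) (fderiv ℝ (fun y => fderiv ℝ u y e) x) x :=
    fun e => ((contDiff_one_partialDeriv hu e).differentiable one_ne_zero x).hasFDerivAt
  have h0 : HasFDerivAt (fun y => fderiv ℝ u y (EuclideanSpace.single 0 1) ^ 2)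
      ((2 * fderiv ℝ u x (EuclideanSpace.single 0 1)) •
        fderiv ℝ (fun y => fderiv ℝ u y (EuclideanSpace.single 0 1)) x) x := by
    simpa using (hdi (EuclideanSpace.single 0 1)).pow 2
  have h1 : HasFDerivAt (fun y => fderiv ℝ u y (EuclideanSpace.single 1 1) ^ 2)
      ((2 * fderiv ℝ u x (EuclideanSpace.single 1 1)) •
        fderiv ℝ (fun y => fderiv ℝ u y (EuclideanSpace.single 1 1)) x) x := by
    simpa using (hdi (EuclideanSpace.single 1 1)).pow 2
  rw [(h0.fun_add h1).fderiv]
  simp only [add_apply, FunLike.coe_smul, Pi.smul_apply, smul_eq_mul, fderiv_partialDeriv_apply hu]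

include hu in
/-- `|∇u|² = (∂₀u)² + (∂₁u)²` is `C¹`. [folklore] -/
theorem contDiff_one_gradSq :
    ContDiff ℝ 1 fun y => fderiv ℝ u y (EuclideanSpace.single 0 1) ^ 2 +
      fderiv ℝ u y (EuclideanSpace.single 1 1) ^ 2 :=
  ((contDiff_one_partialDeriv hu _).pow 2).add ((contDiff_one_partialDeriv hu _).pow 2)

include hu hB in
/-- `xⱼ ∂ᵥ|∇u|²` is integrable. [folklore] -/
theorem integrable_coord_mul_fderiv_gradSq (j : Fin 2) (v : EuclideanSpace ℝ (Fin 2)) :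
    Integrable fun x => x j * fderiv ℝ (fun y => fderiv ℝ u y (EuclideanSpace.single 0 1) ^ 2 +
        fderiv ℝ u y (EuclideanSpace.single 1 1) ^ 2) x v := by
  have hcj : Continuous fun x : EuclideanSpace ℝ (Fin 2) => x j :=
    (continuous_apply j).comp (PiLp.continuous_ofLp 2 _)
  have h2 : ∃ (C : ℝ) (N : ℕ), ∀ x : EuclideanSpace ℝ (Fin 2), |2 * x j| ≤ C * (1 + ‖x‖) ^ N :=
    polyBound_of_le_mul (polyBound_const 2) (polyBound_coord j) fun x => (abs_mul _ _).le
  refine integrable_of_gaussDecay (by norm_num)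
    (hcj.mul (((contDiff_one_gradSq hu).continuous_fderiv one_ne_zero).clm_apply continuous_const))
    (gaussDecay_of_le_add
      (gaussDecay_of_le_poly_mul_mul h2 (gaussDecay_fderiv_apply hB (EuclideanSpace.single 0 1))
        (gaussDecay_fderiv_fderiv_apply hB v (EuclideanSpace.single 0 1))
        (H := fun x => x j * (2 * fderiv ℝ u x (EuclideanSpace.single 0 1) *
          fderiv ℝ (fderiv ℝ u) x v (EuclideanSpace.single 0 1)))
        fun x => le_of_eq (by simp only [abs_mul]; ring))
      (gaussDecay_of_le_poly_mul_mul h2 (gaussDecay_fderiv_apply hB (EuclideanSpace.single 1 1))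
        (gaussDecay_fderiv_fderiv_apply hB v (EuclideanSpace.single 1 1))
        (H := fun x => x j * (2 * fderiv ℝ u x (EuclideanSpace.single 1 1) *
          fderiv ℝ (fderiv ℝ u) x v (EuclideanSpace.single 1 1)))
        fun x => le_of_eq (by simp only [abs_mul]; ring))
      fun x => by rw [fderiv_gradSq_apply hu, mul_add]; exact abs_add_le _ _)

include hu hB in
/-- `∫ xⱼ ∂ᵢ(|∇u|²) = 0` for `i ≠ j` (`∂ᵢxⱼ = 0`, no boundary terms). [folklore] -/
theorem integral_coord_mul_fderiv_gradSq_eq_zero {i j : Fin 2} (hij : i ≠ j) :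
    ∫ x, x j * fderiv ℝ (fun y => fderiv ℝ u y (EuclideanSpace.single 0 1) ^ 2 +
        fderiv ℝ u y (EuclideanSpace.single 1 1) ^ 2) x (EuclideanSpace.single i 1) = 0 := by
  have hE1 := contDiff_one_gradSq hu
  have hd : ∀ x, fderiv ℝ (fun y => y j * (fderiv ℝ u y (EuclideanSpace.single 0 1) ^ 2 +
      fderiv ℝ u y (EuclideanSpace.single 1 1) ^ 2)) x (EuclideanSpace.single i 1) =
      x j * fderiv ℝ (fun y => fderiv ℝ u y (EuclideanSpace.single 0 1) ^ 2 +
        fderiv ℝ u y (EuclideanSpace.single 1 1) ^ 2) x (EuclideanSpace.single i 1) := by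
    intro x
    rw [fderiv_coord_mul_apply (hE1.differentiable one_ne_zero x)]
    simp [hij.symm]
  have hU0 := gaussDecay_fderiv_apply hB (EuclideanSpace.single 0 1)
  have hU1 := gaussDecay_fderiv_apply hB (EuclideanSpace.single 1 1)
  have hcj : Continuous fun x : EuclideanSpace ℝ (Fin 2) => x j :=
    (continuous_apply j).comp (PiLp.continuous_ofLp 2 _)
  have ih : Integrable fun y : EuclideanSpace ℝ (Fin 2) => y j *
      (fderiv ℝ u y (EuclideanSpace.single 0 1) ^ 2 + fderiv ℝ u y (EuclideanSpace.single 1 1) ^ 2) :=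
    integrable_of_gaussDecay (by norm_num) (hcj.mul hE1.continuous)
      (gaussDecay_of_le_add
        (gaussDecay_of_le_poly_mul_mul (polyBound_coord j) hU0 hU0
          (H := fun x => x j * fderiv ℝ u x (EuclideanSpace.single 0 1) ^ 2)
          fun x => by rw [abs_mul, abs_pow, sq, mul_assoc])
        (gaussDecay_of_le_poly_mul_mul (polyBound_coord j) hU1 hU1
          (H := fun x => x j * fderiv ℝ u x (EuclideanSpace.single 1 1) ^ 2)
          fun x => by rw [abs_mul, abs_pow, sq, mul_assoc])
        fun x => by rw [mul_add]; exact abs_add_le _ _)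
  have h := integral_fderiv_apply_eq_zero_of_integrable (contDiff_coord_mul hE1 j) ih
    (EuclideanSpace.single i 1) ((integrable_coord_mul_fderiv_gradSq hu hB j _).congr
      (Eventually.of_forall fun x => (hd x).symm))
  simp_rw [hd] at h
  exact h

include hu hB in
/-- **`⟨Δu, ∂_θu⟩ = 0`**: `∫ Du[x^⊥] Δu = 0` for `u ∈ C²` of Gaussian decay (with two derivatives).
Green once in each coordinate direction; the remaining integrand `∑ᵢ ∂ᵢu ∂ᵢ(∂_θu)` equals
`½ ∂_θ|∇u|² = ½(−x₁∂₀ + x₀∂₁)|∇u|²` (the commutator `[∂ᵢ, ∂_θ]u` is orthogonal to `∇u`, `D²u` is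
symmetric), which integrates to zero. [folklore] -/
theorem integral_fderiv_perp_mul_laplacian_eq_zero :
    ∫ x, fderiv ℝ u x (perp x) * Δ u x = 0 := by
  set e₀ : EuclideanSpace ℝ (Fin 2) := EuclideanSpace.single 0 1 with he₀
  set e₁ : EuclideanSpace ℝ (Fin 2) := EuclideanSpace.single 1 1 with he₁
  have hlap : ∀ x, Δ u x = fderiv ℝ (fderiv ℝ u) x e₀ e₀ + fderiv ℝ (fderiv ℝ u) x e₁ e₁ := fun x => by
    rw [laplacian_eq_sum_fderiv_fderiv (EuclideanSpace.basisFun (Fin 2) ℝ) hu x, Fin.sum_univ_two,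
      EuclideanSpace.basisFun_apply, EuclideanSpace.basisFun_apply, fderiv_partialDeriv_apply hu,
      fderiv_partialDeriv_apply hu]
  have hθ1 : ContDiff ℝ 1 fun y => fderiv ℝ u y (perp y) := contDiff_one_angularDeriv hu
  have hUθ := gaussDecay_fderiv_perp hB
  have hcθ := continuous_fderiv_perp_of_contDiff_two hu
  -- integrands after one integration by parts
  have ia : ∀ e, Integrable fun x =>
      (fderiv ℝ u x (perp e) + fderiv ℝ (fderiv ℝ u) x e (perp x)) * fderiv ℝ u x e := by
    intro e
    have hUe := gaussDecay_fderiv_apply hB e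
    exact integrable_of_gaussDecay (by norm_num)
      (((continuous_fderiv_apply_of_contDiff_two hu (perp e)).add
        (continuous_fderiv_fderiv_perp_of_contDiff_two hu e)).mul (continuous_fderiv_apply_of_contDiff_two hu e))
      (gaussDecay_of_le_add
        (gaussDecay_of_le_poly_mul_mul (polyBound_const 1) (gaussDecay_fderiv_apply hB (perp e)) hUe
          (H := fun x => fderiv ℝ u x (perp e) * fderiv ℝ u x e) fun x => by
            rw [abs_mul, abs_one, one_mul])
        (gaussDecay_of_le_poly_mul_mul (polyBound_const 1) (gaussDecay_fderiv_fderiv_perp hB e) hUe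
          (H := fun x => fderiv ℝ (fderiv ℝ u) x e (perp x) * fderiv ℝ u x e) fun x => by
            rw [abs_mul, abs_one, one_mul])
        fun x => by rw [add_mul]; exact abs_add_le _ _)
  have ib : ∀ e, Integrable fun x => fderiv ℝ u x (perp x) * fderiv ℝ (fderiv ℝ u) x e e := fun e =>
    integrable_of_gaussDecay (by norm_num) (hcθ.mul (continuous_fderiv_fderiv_apply_of_contDiff_two hu e e))
      (gaussDecay_of_le_poly_mul_mul (polyBound_const 1) hUθ (gaussDecay_fderiv_fderiv_apply hB e e)
        fun x => by rw [abs_mul, abs_one, one_mul])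
  -- one integration by parts in each direction
  have key : ∀ e, ∫ x, fderiv ℝ u x (perp x) * fderiv ℝ (fderiv ℝ u) x e e =
      -∫ x, (fderiv ℝ u x (perp e) + fderiv ℝ (fderiv ℝ u) x e (perp x)) * fderiv ℝ u x e := by
    intro e
    have hd : ∀ x, fderiv ℝ (fun y => fderiv ℝ u y (perp y) * fderiv ℝ u y e) x e =
        (fderiv ℝ u x (perp e) + fderiv ℝ (fderiv ℝ u) x e (perp x)) * fderiv ℝ u x e +
          fderiv ℝ u x (perp x) * fderiv ℝ (fderiv ℝ u) x e e := by
      intro x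
      have hθd : HasFDerivAt (fun y => fderiv ℝ u y (perp y))
          (fderiv ℝ (fun y => fderiv ℝ u y (perp y)) x) x := (hθ1.differentiable one_ne_zero x).hasFDerivAt
      have hdi : HasFDerivAt (fun y => fderiv ℝ u y e) (fderiv ℝ (fun y => fderiv ℝ u y e) x) x :=
        ((contDiff_one_partialDeriv hu e).differentiable one_ne_zero x).hasFDerivAt
      rw [(hθd.fun_mul hdi).fderiv]
      simp only [add_apply, FunLike.coe_smul, Pi.smul_apply, smul_eq_mul, fderiv_partialDeriv_apply hu,
        fderiv_angularDeriv_apply hu]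
      ring
    have ih : Integrable fun y => fderiv ℝ u y (perp y) * fderiv ℝ u y e :=
      integrable_of_gaussDecay (by norm_num) (hcθ.mul (continuous_fderiv_apply_of_contDiff_two hu e))
        (gaussDecay_of_le_poly_mul_mul (polyBound_const 1) hUθ (gaussDecay_fderiv_apply hB e) fun x => by
          rw [abs_mul, abs_one, one_mul])
    exact integral_eq_neg_integral_of_fderiv_eq_add (hθ1.mul (contDiff_one_partialDeriv hu e)) ih e
      (ia e) (ib e) hd
  -- the remaining integrand is `½ ∂_θ |∇u|² = ½ (−x₁ ∂₀ + x₀ ∂₁)|∇u|²`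
  set E : EuclideanSpace ℝ (Fin 2) → ℝ := fun y => fderiv ℝ u y e₀ ^ 2 + fderiv ℝ u y e₁ ^ 2 with hE
  have hdE : ∀ x w, fderiv ℝ E x w = 2 * fderiv ℝ u x e₀ * fderiv ℝ (fderiv ℝ u) x w e₀ +
      2 * fderiv ℝ u x e₁ * fderiv ℝ (fderiv ℝ u) x w e₁ := fun x w => fderiv_gradSq_apply hu x w
  have hrem : ∀ x, (fderiv ℝ u x (perp e₀) + fderiv ℝ (fderiv ℝ u) x e₀ (perp x)) * fderiv ℝ u x e₀ +
      (fderiv ℝ u x (perp e₁) + fderiv ℝ (fderiv ℝ u) x e₁ (perp x)) * fderiv ℝ u x e₁ =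
      -(1 / 2) * (x 1 * fderiv ℝ E x e₀) + (1 / 2) * (x 0 * fderiv ℝ E x e₁) := by
    intro x
    rw [hdE, hdE, he₀, he₁, perp_single_zero_eq, perp_single_one_eq, map_neg,
      fderiv_fderiv_symm_of_contDiff_two hu x (EuclideanSpace.single 0 1) (perp x),
      fderiv_fderiv_symm_of_contDiff_two hu x (EuclideanSpace.single 1 1) (perp x),
      perp_eq_smul_single_add x, map_add, map_smul, map_smul]
    simp only [add_apply, FunLike.coe_smul, Pi.smul_apply, smul_eq_mul,
      fderiv_fderiv_symm_of_contDiff_two hu x (EuclideanSpace.single 1 1) (EuclideanSpace.single 0 1)]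
    ring
  have hZ0 : ∫ x, x 1 * fderiv ℝ E x e₀ = 0 :=
    integral_coord_mul_fderiv_gradSq_eq_zero hu hB (i := 0) (j := 1) (by decide)
  have hZ1 : ∫ x, x 0 * fderiv ℝ E x e₁ = 0 :=
    integral_coord_mul_fderiv_gradSq_eq_zero hu hB (i := 1) (j := 0) (by decide)
  have ia0 : Integrable fun x => -(1 / 2) * (x 1 * fderiv ℝ E x e₀) :=
    (integrable_coord_mul_fderiv_gradSq hu hB 1 e₀).const_mul _
  have ia1 : Integrable fun x => (1 / 2) * (x 0 * fderiv ℝ E x e₁) :=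
    (integrable_coord_mul_fderiv_gradSq hu hB 0 e₁).const_mul _
  have eL : ∀ x, fderiv ℝ u x (perp x) * Δ u x =
      fderiv ℝ u x (perp x) * fderiv ℝ (fderiv ℝ u) x e₀ e₀ +
        fderiv ℝ u x (perp x) * fderiv ℝ (fderiv ℝ u) x e₁ e₁ := fun x => by rw [hlap]; ring
  simp_rw [eL]
  rw [integral_add (ib e₀) (ib e₁), key e₀, key e₁, ← neg_add, ← integral_add (ia e₀) (ia e₁)]
  simp_rw [hrem]
  rw [integral_add ia0 ia1, integral_const_mul, integral_const_mul, hZ0, hZ1]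
  ring
end Decay

/-- Registered tools stub of crux stmt-NavierStokesRegularity-17973 (`stub_oddAttenuationToolsC`):
`∫ xⱼ ∂ᵢ|∇u|² = 0` (`i ≠ j`) and `⟨Δu, ∂_θu⟩ = 0` in the Gaussian decay class. [folklore] -/
theorem stub_oddAttenuationToolsC :
    (∀ (u : EuclideanSpace ℝ (Fin 2) → ℝ), ContDiff ℝ 2 u → (∃ (C : ℝ) (N : ℕ), ∀ x, |u x| ≤ C * (1
      + ‖x‖) ^ N * Real.exp (-(1 / 8 * ‖x‖ ^ 2)) ∧ ‖fderiv ℝ u x‖ ≤ C * (1 + ‖x‖) ^ N * Real.exp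
      (-(1 / 8 * ‖x‖ ^ 2)) ∧ ‖fderiv ℝ (fderiv ℝ u) x‖ ≤ C * (1 + ‖x‖) ^ N * Real.exp (-(1 / 8 * ‖x‖
      ^ 2))) → ∀ (i j : Fin 2), i ≠ j → ∫ x, x j * fderiv ℝ (fun y => fderiv ℝ u y
      (EuclideanSpace.single 0 1) ^ 2 + fderiv ℝ u y (EuclideanSpace.single 1 1) ^ 2) x
      (EuclideanSpace.single i 1) = 0) ∧ (∀ (u : EuclideanSpace ℝ (Fin 2) → ℝ), ContDiff ℝ 2 u → (∃
      (C : ℝ) (N : ℕ), ∀ x, |u x| ≤ C * (1 + ‖x‖) ^ N * Real.exp (-(1 / 8 * ‖x‖ ^ 2)) ∧ ‖fderiv ℝ u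
      x‖ ≤ C * (1 + ‖x‖) ^ N * Real.exp (-(1 / 8 * ‖x‖ ^ 2)) ∧ ‖fderiv ℝ (fderiv ℝ u) x‖ ≤ C * (1 +
      ‖x‖) ^ N * Real.exp (-(1 / 8 * ‖x‖ ^ 2))) → ∫ x, fderiv ℝ u x (perp x) * Δ u x = 0) :=
  ⟨fun _ hu hB _ _ hij => integral_coord_mul_fderiv_gradSq_eq_zero hu hB hij,
    fun _ hu hB => integral_fderiv_perp_mul_laplacian_eq_zero hu hB⟩

end Summit.NavierStokesRegularity.NavierStokesRegularity.Theorems
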